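import Summits.BirchSwinnertonDyer.BirchSwinnertonDyer.Theorems.PlecticLegsArtinBaseChangeEuler
import Mathlib.NumberTheory.LSeries.Deriv

/-!
# Artin formalism for `L(E/F, s)`, `F = ℚ(ζ_m)^H`: the `L`-series identity

Route `PlecticLegs`, support item `ArtinBaseChange` (stmt-BirchSwinnertonDyer-18261). From the
identity of formal Euler products (`PlecticLegsArtinBaseChangeEuler`) to the identity of convergent
Dirichlet series on `Re s > 3/2`:
`L(E_F, s) · P_F(s) = L(E, s) · P(s) · ∏_{χ ∈ Y_H, χ ≠ 1} (∑ χ(n) aₙ(E) n^{-s})`, where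
`P_F(s) = ∏_{w ∣ m} L_w(E_F, N w^{-s})` and `P(s) = ∏_{p ∣ m} L_p(E, p^{-s})` are Dirichlet
polynomials — entire and non-vanishing at `s = 1` (`L_w(q^{-1}) = #Ẽ(k_w)/q`, `1 ∓ q⁻¹` or `1`).
This is the input `exists_LSeries_baseChange_fixedField_identity` of the analytic assembly of
`ArtinBaseChange`.
-/

noncomputable section

-- D-0017: single-problem summit, so `Summit.BirchSwinnertonDyer.BirchSwinnertonDyer.…` repeats a
-- namespace BY DESIGN.
set_option linter.dupNamespace false

open scoped Classical
open Filter ArithmeticFunction NumberField IsDedekindDomain WeierstrassCurve Polynomial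
  IsCyclotomicExtension.Rat Literature.NumberTheory.EllipticCurves LSeries

namespace Summit.BirchSwinnertonDyer.BirchSwinnertonDyer.Theorems

/-! ## `L`-series of finite products and of Dirichlet polynomials -/

section LSeriesLemmas

/-- `L`-series of a finite product of arithmetic functions with summable `L`-series: summable,
and equal to the product of the `L`-series. [folklore] -/
theorem LSeriesSummable_and_LSeries_finset_prod {α : Type*} (s : Finset α)
    (f : α → ArithmeticFunction ℂ) (z : ℂ) (hf : ∀ a ∈ s, LSeriesSummable (⇑(f a)) z) :
    LSeriesSummable (⇑(∏ a ∈ s, f a)) z ∧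
      LSeries (⇑(∏ a ∈ s, f a)) z = ∏ a ∈ s, LSeries (⇑(f a)) z := by
  induction s using Finset.induction_on with
  | empty =>
    simp only [Finset.prod_empty]
    have h1 : (⇑(1 : ArithmeticFunction ℂ) : ℕ → ℂ) = LSeries.delta := ArithmeticFunction.one_eq_delta
    rw [h1, LSeries_delta, Pi.one_apply]
    refine ⟨summable_of_ne_finset_zero (s := {1}) fun n hn ↦ ?_, rfl⟩
    rw [Finset.mem_singleton] at hn
    rw [term_delta, if_neg hn]
  | insert a s ha ih =>
    have hfa := hf a (Finset.mem_insert_self a s)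
    obtain ⟨hs1, hs2⟩ := ih fun b hb ↦ hf b (Finset.mem_insert_of_mem hb)
    rw [Finset.prod_insert ha, Finset.prod_insert ha]
    exact ⟨ArithmeticFunction.LSeriesSummable_mul hfa hs1,
      by rw [ArithmeticFunction.LSeries_mul' hfa hs1, hs2]⟩

/-- The `L`-series of `P(q^{-s})`, `P` a polynomial and `q > 1` (the arithmetic function
`ofPowerSeries q P`), has only finitely many non-zero terms, indexed by `q^k`, `k ≤ deg P`.
[folklore] -/
theorem term_intCoe_ofPowerSeries_eq_zero {q : ℕ} (hq : 1 < q) (P : ℤ[X]) (s : ℂ) {n : ℕ}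
    (hn : n ∉ (Finset.range (P.natDegree + 1)).image (q ^ ·)) :
    term (⇑((ofPowerSeries q (P : PowerSeries ℤ) : ArithmeticFunction ℤ) : ArithmeticFunction ℂ))
      s n = 0 := by
  rcases Nat.eq_zero_or_pos n with rfl | hn0
  · exact term_zero _ _
  rw [term_of_ne_zero hn0.ne', intCoe_apply]
  suffices h : ofPowerSeries q (P : PowerSeries ℤ) n = 0 by rw [h, Int.cast_zero, zero_div]
  by_cases hk : ∃ k, q ^ k = n
  · obtain ⟨k, rfl⟩ := hk
    rw [ofPowerSeries_apply_pow hq, Polynomial.coeff_coe]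
    refine Polynomial.coeff_eq_zero_of_natDegree_lt ?_
    by_contra hlt
    exact hn (Finset.mem_image.mpr ⟨k, Finset.mem_range.mpr (by omega), rfl⟩)
  · rw [ofPowerSeries_apply hq, Function.extend_apply' _ _ _ hk, Pi.zero_apply]

/-- The `L`-series of a Dirichlet polynomial `P(q^{-s})` converges everywhere. [folklore] -/
theorem LSeriesSummable_intCoe_ofPowerSeries {q : ℕ} (hq : 1 < q) (P : ℤ[X]) (s : ℂ) :
    LSeriesSummable
      (⇑((ofPowerSeries q (P : PowerSeries ℤ) : ArithmeticFunction ℤ) : ArithmeticFunction ℂ)) s :=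
  summable_of_ne_finset_zero fun _ hn ↦ term_intCoe_ofPowerSeries_eq_zero hq P s hn

/-- **The value at `s = 1` of the Dirichlet polynomial `P(q^{-s})` is `P(q⁻¹)`.** [folklore] -/
theorem LSeries_intCoe_ofPowerSeries_one {q : ℕ} (hq : 1 < q) (P : ℤ[X]) :
    LSeries (⇑((ofPowerSeries q (P : PowerSeries ℤ) : ArithmeticFunction ℤ) : ArithmeticFunction ℂ))
      1 = (P.map (Int.castRingHom ℂ)).eval ((q : ℂ)⁻¹) := by
  rw [LSeries, tsum_eq_sum (s := (Finset.range (P.natDegree + 1)).image (q ^ ·))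
    (fun n hn ↦ term_intCoe_ofPowerSeries_eq_zero hq P 1 hn),
    Finset.sum_image fun a _ b _ h ↦ Nat.pow_right_injective hq h,
    Polynomial.eval_eq_sum_range' (lt_of_le_of_lt (natDegree_map_le) (Nat.lt_succ_self _))]
  refine Finset.sum_congr rfl fun k _ ↦ ?_
  have hqk : q ^ k ≠ 0 := pow_ne_zero _ (by omega)
  rw [term_of_ne_zero hqk, intCoe_apply, ofPowerSeries_apply_pow hq, Polynomial.coeff_coe,
    Polynomial.coeff_map, Complex.cpow_one, eq_intCast, Nat.cast_pow, div_eq_mul_inv, inv_pow]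

/-- An `L`-series converging everywhere is entire. [folklore] -/
theorem differentiable_LSeries_of_forall_LSeriesSummable {f : ℕ → ℂ}
    (h : ∀ z : ℂ, LSeriesSummable f z) : Differentiable ℂ (LSeries f) := by
  have hab : abscissaOfAbsConv f = ⊥ :=
    le_bot_iff.mp (abscissaOfAbsConv_le_of_forall_lt_LSeriesSummable' fun y _ ↦ h y)
  intro z
  have hz : z ∈ {s : ℂ | abscissaOfAbsConv f < s.re} := by
    rw [Set.mem_setOf_eq, hab]
    exact EReal.bot_lt_coe _
  exact (LSeries_differentiableOn f z hz).differentiableAt ((Complex.isOpen_re_gt_EReal _).mem_nhds hz)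

/-- **The local polynomial does not vanish at `T = q⁻¹`** (`q = #k_v > 1` finite): in the good case
`L_v(q⁻¹) = (q + 1 - a_v)/q = #Ẽ(k_v)/q` with `#Ẽ(k_v) ≥ 1` (the point at infinity), otherwise
`1 ∓ q⁻¹` or `1`. Hence the Euler factors at `s = 1` removed in Artin formalism are harmless.
[folklore] -/
theorem eval_localPolynomial_ne_zero (R : Type*) [CommRing R] [IsDomain R]
    [IsDiscreteValuationRing R] {L : Type*} [Field L] [Algebra R L] [IsFractionRing R L]
    (X : WeierstrassCurve L) (hq : 1 < Nat.card (IsLocalRing.ResidueField R)) :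
    ((X.localPolynomial R).map (Int.castRingHom ℂ)).eval
      ((Nat.card (IsLocalRing.ResidueField R) : ℂ)⁻¹) ≠ 0 := by
  set q := Nat.card (IsLocalRing.ResidueField R) with hqdef
  have hq0 : (q : ℂ) ≠ 0 := by exact_mod_cast (by omega : q ≠ 0)
  haveI : Finite (IsLocalRing.ResidueField R) := Nat.finite_of_card_ne_zero (by omega)
  letI : Fintype (IsLocalRing.ResidueField R) := Fintype.ofFinite _
  unfold localPolynomial
  split_ifs with hgood hsplit hmult
  · -- good reduction: `#Ẽ(k)/q ≠ 0`
    set N := Nat.card ((X.minimal R).reduction R).toAffine.Point with hN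
    have hN1 : 1 ≤ N := WeierstrassCurve.one_le_natCard_point _
    rw [← hqdef]
    simp only [Polynomial.map_add, Polynomial.map_sub, Polynomial.map_one, Polynomial.map_mul,
      Polynomial.map_pow, Polynomial.map_natCast, map_X, eq_intCast, eval_add, eval_sub, eval_one,
      eval_mul, eval_natCast, eval_X, eval_pow, Int.cast_sub, Int.cast_add, Int.cast_natCast,
      Int.cast_one]
    have h : (1 - ((q : ℂ) + 1 - N) * (q : ℂ)⁻¹ + (q : ℂ) * ((q : ℂ)⁻¹) ^ 2) = (N : ℂ) / q := by
      field_simp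
      ring
    rw [h]
    exact div_ne_zero (by exact_mod_cast (by omega : N ≠ 0)) hq0
  · -- split multiplicative: `1 - q⁻¹ ≠ 0`
    simp only [Polynomial.map_sub, Polynomial.map_one, map_X, eval_sub, eval_one, eval_X]
    rw [sub_ne_zero, Ne, eq_comm, inv_eq_one]
    exact_mod_cast hq.ne'
  · -- non-split multiplicative: `1 + q⁻¹ ≠ 0`
    simp only [Polynomial.map_add, Polynomial.map_one, map_X, eval_add, eval_one, eval_X]
    have h : (1 + (q : ℂ)⁻¹) = ((q + 1 : ℕ) : ℂ) / q := by
      field_simp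
      push_cast
      ring
    rw [h]
    exact div_ne_zero (by exact_mod_cast Nat.succ_ne_zero q) hq0
  · simp

end LSeriesLemmas

/-! ## The `L`-series identity -/

section Identity

variable (W : WeierstrassCurve ℚ) [W.IsElliptic] (m : ℕ) [NeZero m] (K : Type) [Field K]
  [NumberField K] [IsCyclotomicExtension {m} ℚ K] [IsGalois ℚ K] [IsMulCommutative Gal(K/ℚ)]
  (H : Subgroup Gal(K/ℚ))

/-- **Artin formalism for `L(E/F, s)`, `F = ℚ(ζ_m)^H`, as an identity of Dirichlet series.** There
are entire functions `P, Q`, non-vanishing at `s = 1` (the Dirichlet polynomials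
`P(s) = ∏_{w ∣ m} L_w(E_F, N w^{-s})`, `Q(s) = ∏_{p ∣ m} L_p(E, p^{-s})`), such that for `Re s > 3/2`
`L(E_F, s) · P(s) = L(E, s) · Q(s) · ∏_{χ ∈ Y_H, χ ≠ 1} (∑ₙ χ(n) aₙ(E) n^{-s})`, i.e.
`L^{(m)}(E/F, s) = ∏_{χ} L^{(m)}(E, χ, s)` with the trivial character's factor `L^{(m)}(E, s)`
written as `L(E, s) Q(s)` (Ireland–Rosen Prop. 20.5.4 in degree `2`; Artin). [folklore] -/
theorem exists_LSeries_baseChange_fixedField_identity :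
    ∃ P Q : ℂ → ℂ, Differentiable ℂ P ∧ Differentiable ℂ Q ∧ P 1 ≠ 0 ∧ Q 1 ≠ 0 ∧
      ∀ s : ℂ, (3 / 2 : ℝ) < s.re →
        (W.baseChange ↥(IntermediateField.fixedField H)).LSeries s * P s =
          W.LSeries s * Q s *
            ∏ χ ∈ (Finset.univ.filter (fun χ : DirichletCharacter ℂ m ↦
                χ ∈ (subgroupGalEquivSubgroupChar m K ℂ H).ofDual)).erase 1,
              LSeries (fun n ↦ χ (n : ZMod m) * ((W.LFunction n : ℤ) : ℂ)) s := by
  set F := IntermediateField.fixedField H with hFdef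
  set S := (finite_setOf_natCast_mem m).toFinset with hSdef
  set Yf := Finset.univ.filter (fun χ : DirichletCharacter ℂ m ↦
    χ ∈ (subgroupGalEquivSubgroupChar m K ℂ H).ofDual) with hYf
  -- the two Dirichlet polynomials
  set ΨF : HeightOneSpectrum (𝓞 ℚ) → ArithmeticFunction ℤ := fun v ↦
    ∏ᶠ w ∈ {w : HeightOneSpectrum (𝓞 ↥F) | w.under (𝓞 ℚ) = v},
      ofPowerSeries w.residueCard (((W.baseChange ↥F).localPolynomialAt w : ℤ[X]) : PowerSeries ℤ)
    with hΨF
  set Ψ : HeightOneSpectrum (𝓞 ℚ) → ArithmeticFunction ℤ := fun v ↦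
    ofPowerSeries v.residueCard ((W.localPolynomialAt v : ℤ[X]) : PowerSeries ℤ) with hΨ
  set PF : ArithmeticFunction ℂ := ∏ v ∈ S, (ΨF v : ArithmeticFunction ℂ) with hPF
  set PE : ArithmeticFunction ℂ := ∏ v ∈ S, (Ψ v : ArithmeticFunction ℂ) with hPE
  -- each `ΨF v` is a finite product of Dirichlet polynomials
  have hΨF' : ∀ v, (ΨF v : ArithmeticFunction ℂ) =
      ∏ w ∈ (v.finite_setOf_under_eq_of_numberField (K := ↥F)).toFinset,
        ((ofPowerSeries w.residueCard (((W.baseChange ↥F).localPolynomialAt w : ℤ[X]) :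
          PowerSeries ℤ) : ArithmeticFunction ℤ) : ArithmeticFunction ℂ) := by
    intro v
    rw [hΨF]
    simp only
    rw [finprod_mem_eq_finite_toFinset_prod _ (v.finite_setOf_under_eq_of_numberField (K := ↥F)),
      intCoe_finset_prod]
  -- summability everywhere and values at `1`
  have hΨFs : ∀ v z, LSeriesSummable (⇑(ΨF v : ArithmeticFunction ℂ)) z ∧
      LSeries (⇑(ΨF v : ArithmeticFunction ℂ)) z =
        ∏ w ∈ (v.finite_setOf_under_eq_of_numberField (K := ↥F)).toFinset,
          LSeries (⇑((ofPowerSeries w.residueCard (((W.baseChange ↥F).localPolynomialAt w : ℤ[X]) :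
            PowerSeries ℤ) : ArithmeticFunction ℤ) : ArithmeticFunction ℂ)) z := by
    intro v z
    rw [hΨF' v]
    exact LSeriesSummable_and_LSeries_finset_prod _ _ z fun w _ ↦
      LSeriesSummable_intCoe_ofPowerSeries w.one_lt_residueCard _ z
  have hPFs : ∀ z, LSeriesSummable (⇑PF) z ∧
      LSeries (⇑PF) z = ∏ v ∈ S, LSeries (⇑(ΨF v : ArithmeticFunction ℂ)) z := fun z ↦
    LSeriesSummable_and_LSeries_finset_prod _ _ z fun v _ ↦ (hΨFs v z).1
  have hPEs : ∀ z, LSeriesSummable (⇑PE) z ∧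
      LSeries (⇑PE) z = ∏ v ∈ S, LSeries (⇑(Ψ v : ArithmeticFunction ℂ)) z := fun z ↦
    LSeriesSummable_and_LSeries_finset_prod _ _ z fun v _ ↦
      LSeriesSummable_intCoe_ofPowerSeries v.one_lt_residueCard _ z
  refine ⟨LSeries (⇑PF), LSeries (⇑PE),
    differentiable_LSeries_of_forall_LSeriesSummable fun z ↦ (hPFs z).1,
    differentiable_LSeries_of_forall_LSeriesSummable fun z ↦ (hPEs z).1, ?_, ?_, ?_⟩
  · -- `P 1 ≠ 0`
    rw [(hPFs 1).2]
    refine Finset.prod_ne_zero_iff.mpr fun v _ ↦ ?_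
    rw [(hΨFs v 1).2]
    refine Finset.prod_ne_zero_iff.mpr fun w _ ↦ ?_
    rw [LSeries_intCoe_ofPowerSeries_one w.one_lt_residueCard,
      ← natCard_residueField_eq_residueCard w]
    exact eval_localPolynomial_ne_zero _ _ (by
      rw [natCard_residueField_eq_residueCard w]; exact w.one_lt_residueCard)
  · -- `Q 1 ≠ 0`
    rw [(hPEs 1).2]
    refine Finset.prod_ne_zero_iff.mpr fun v _ ↦ ?_
    rw [hΨ]
    simp only
    rw [LSeries_intCoe_ofPowerSeries_one v.one_lt_residueCard,
      ← natCard_residueField_eq_residueCard v]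
    exact eval_localPolynomial_ne_zero _ _ (by
      rw [natCard_residueField_eq_residueCard v]; exact v.one_lt_residueCard)
  · -- the identity on `Re s > 3/2`
    intro s hs
    haveI : (W.baseChange ↥F).IsElliptic := by rw [baseChange]; infer_instance
    have haFs : LSeriesSummable
        (⇑(((W.baseChange ↥F).LFunction : ArithmeticFunction ℤ) : ArithmeticFunction ℂ)) s :=
      (W.baseChange ↥F).LSeriesSummable_of_lt_re_holds hs
    have has : LSeriesSummable (⇑((W.LFunction : ArithmeticFunction ℤ) : ArithmeticFunction ℂ)) s :=
      W.LSeriesSummable_of_lt_re_holds hs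
    have htw : ∀ χ : DirichletCharacter ℂ m,
        ⇑((toArithmeticFunction (fun k : ℕ ↦ χ (k : ZMod m))).pmul
          ((W.LFunction : ArithmeticFunction ℤ) : ArithmeticFunction ℂ)) =
          fun n : ℕ ↦ χ (n : ZMod m) * ((W.LFunction n : ℤ) : ℂ) := by
      intro χ
      funext n
      rw [twist_apply, intCoe_apply]
    have htws : ∀ χ : DirichletCharacter ℂ m, LSeriesSummable
        (⇑((toArithmeticFunction (fun k : ℕ ↦ χ (k : ZMod m))).pmul
          ((W.LFunction : ArithmeticFunction ℤ) : ArithmeticFunction ℂ))) s := by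
      intro χ
      rw [htw]
      exact DirichletCharacter.LSeriesSummable_mul χ has
    -- Artin formalism
    have h1 := congrArg (fun f : ArithmeticFunction ℂ ↦ LSeries (⇑f) s)
      (intCoe_LFunction_baseChange_mul_eq_prod_twist W m K H)
    have h2 := congrArg (fun f : ArithmeticFunction ℂ ↦ LSeries (⇑f) s)
      (intCoe_LFunction_mul_eq_twist_one W m)
    rw [ArithmeticFunction.LSeries_mul' haFs (hPFs s).1,
      (LSeriesSummable_and_LSeries_finset_prod _ _ s fun χ _ ↦ htws χ).2] at h1
    rw [ArithmeticFunction.LSeries_mul' has (hPEs s).1] at h2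
    have h1mem : (1 : DirichletCharacter ℂ m) ∈ Yf := by
      rw [hYf, Finset.mem_filter]
      exact ⟨Finset.mem_univ _, one_mem _⟩
    rw [← Finset.mul_prod_erase Yf _ h1mem, ← h2] at h1
    change LSeries (⇑(((W.baseChange ↥F).LFunction : ArithmeticFunction ℤ) : ArithmeticFunction ℂ)) s *
      LSeries (⇑PF) s = LSeries (⇑((W.LFunction : ArithmeticFunction ℤ) : ArithmeticFunction ℂ)) s *
        LSeries (⇑PE) s * _
    rw [h1]
    congr 1
    refine Finset.prod_congr rfl fun χ _ ↦ ?_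
    rw [htw]

end Identity

end Summit.BirchSwinnertonDyer.BirchSwinnertonDyer.Theorems

end
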